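import Literature.NumberTheory.Automorphic.AutomorphicFormsL2OrbitalSmoothingChart
import Literature.NumberTheory.Automorphic.AutomorphicFormsL2InvariantAverage
import Literature.NumberTheory.Automorphic.UnitaryGroupArchFactor
import Literature.NumberTheory.Automorphic.UnitaryGroupAdelicProductHaar
import Literature.NumberTheory.Automorphic.UnitaryGroupRestrictedProduct
import Summits.HodgeConjecture.HodgeConjecture.Theorems.F0P2dStubREngine
import HarnessLib

/-!
# Crux `HLiu418`, K-lane sub-line `F0_P5TP2SpectralProjection` — stub **(R₂)** `stub_R₂ : StubR₂RegularOfReproduced`, ENGINE HALF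
# (generic rank `N`, ONE complex place `w₁`): exactly `K_c K_f`-invariant representatives, «every orbit function along
# `adelicSingle w₁` is locally integrable», continuity of orbital integrals on `U(J)(𝔸_F)`

Cell hodgecm-mathlib (D-0151), FLOOR 0, programme P5 (Alb-CM), crux item `HLiu418` = stmt-HodgeConjecture-24832; K-lane sub-line
`Cruxes/HLiu418/Lines/F0_P5TP2SpectralProjection.lean` (skeleton v0 by A-p14 (g16), sha16 ce659ab5fe57535c; F0P5-plan (g0) SHAPE PASS
2026-08-31T02:03:58Z; registration by A-plan1 (g18) pending), stub **(R₂) `stub_R₂ : StubR₂RegularOfReproduced`** (hand A-p04 (g21): pen word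
A-p14 02:07:24Z, desk word F0P5-plan 02:08:08Z).  THEOREMS ONLY (no definition, no instance, no notation, no named fact, no `sorry`);
`--supports stmt-HodgeConjecture-24832 --as helper`.  HC_CM is proved only modulo the 7 printed citations until rung 0 closes; this file
proves nothing about them.  Companion (the closer): `Theorems/F0P5TP2StubR2.lean :: stubR₂_holds`.

This is the rank-`N`, one-place port of ★ `Theorems/F0P2dStubREngine` (F0P2-p04 (g2), rank 3 through the frame section `cmArchSection`),
re-threaded on the tree's GENERIC one-place archimedean factorisation ★ `UnitaryGroupArchFactor` (`adelicSingle w₁`, `K_c(w₁) =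
(ker archAt w₁).map archToAdelic`, the three commutations, the decomposition `x = adelicSingle w₁ u · k · (1, g)`), so that the P5 sub-line
instantiates it at `(F, E, c, N, J, w₁) = (L⁺, L, c̄, 2, H, cmPlace L ι)` — where `adelicSingle … (cmPlace L ι)` IS the skeleton's `sec₁ L ι H`
and `(ker archAt (cmPlace L ι)).map archToAdelic` IS its `Kc₁ L ι H`, token for token.

SETTING: `U := U(σ_{w₁} J)(ℂ) = archLocal E N J w₁ ≤ GL_N(ℂ)` with ANY Borel structure (binders `[MeasurableSpace U] [BorelSpace U]`, as in
the skeleton) and a Haar measure `ν`; `sec := adelicSingle w₁ : U →* U(J)(𝔸_F)`; `K_c := (ker archAt w₁).map archToAdelic` (the archimedean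
factor away from `w₁`), assumed COMPACT (`hKc`; at the sub-line: `H` definite at the complex places `≠ cmPlace L ι`, ★ `isCompact_map_ker_archAt`
— the closer derives it from the letter's diagonalisation binders); `(1, ·) = finAdelicToAdelic`.
* §0 `U` is second countable and locally compact (closed subgroup of `GL_N(ℂ)`); `K_c`, `(1, U(J)(𝔸_{F,f}))` and `sec(U)` pairwise commute (★).
* §1 `exists_invariant_representative`: an `L²` class fixed by the compact `K_c` and by a compact `K_f` has a strongly measurable
  representative invariant under `K_c` and `(1, K_f)` AT EVERY POINT (average over `K_c`, then `K_f`; ★ `AutomorphicFormsL2InvariantAverage`;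
  the normalised Haar probability measure is ★ `F0P2dStubR.exists_isProbabilityMeasure_isMulLeftInvariant`, reused by import).
* §2 `locallyIntegrable_orbitFun_of_invariant(')`: for such a representative (with `K_f` OPEN) EVERY orbit function `u ↦ F(sec(u)⁻¹ • ξ)` is
  locally integrable — the bad set is `μ`-null (★ `ae_locallyIntegrable_orbitFun`) and OPEN (its preimage in `U(J)(𝔸_F)` is stable under left
  multiplication by `sec(U) · K_c · (1, K_f) ⊇ {z | z_f ∈ K_f}`), hence EMPTY (`μ` charges opens); right invariances of orbital integrals
  `x ↦ ∫ β(u) φ(x sec u) dν` (`β ∈ C_c(U)`, `φ = invQuot F`) under `K_c` and `(1, K_f)`; and their CONTINUITY ON `U(J)(𝔸_F)`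
  (`continuous_orbitalIntegral_of_invariant`: near `x₀` they equal `Θ(x₀ · sec((x₀⁻¹x)_{w₁}))` by the decomposition and the exact right
  invariances; ★ `continuous_orbitalIntegral_mul_hom` along the orbit).
Per A-p02 (g18)'s ★ `UnitaryGroupSliceContinuity` (2026-08-31) the last step is also an instance of `continuous_of_continuous_slice`; the direct
40-line argument is kept here so that this file depends on ★ modules only.

## References
* [BorelJacquet1979] A. Borel, H. Jacquet, Corvallis PSPM 33.1 (1979), §4.1–4.2, §4.6.  [Borel1997] A. Borel, *Automorphic forms on SL₂(ℝ)*
  (1997), Thm. 2.13–2.14, §8.4.  [Folland1995] G. B. Folland (1995), §2.2, §3.2.  [HarishChandra1966] Acta Math. 116 (1966), §8.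
* [PlatonovRapinchuk1994] V. Platonov, A. Rapinchuk, *Algebraic groups and number theory* (1994), §5.1, §3.2 Thm. 3.1.
-/

set_option autoImplicit false
-- the mandated namespace has the single-problem summit's repeated segment (`HodgeConjecture.HodgeConjecture`)
set_option linter.dupNamespace false

noncomputable section

namespace Summit.HodgeConjecture.HodgeConjecture.Cruxes.HLiu418.F0P5TP2StubR2Engine

open scoped Topology ENNReal Pointwise Matrix ComplexOrder
open MeasureTheory NumberField NumberField.InfinitePlace Set Filter Function
open Literature.NumberTheory.Automorphic Literature.NumberTheory.Automorphic.UnitaryGroup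

variable (F E : Type) [Field F] [NumberField F] [Field E] [NumberField E] [Algebra F E]
  (c : E ≃ₐ[F] E) (N : ℕ) (J : Matrix (Fin N) (Fin N) E) (hc : c ≠ 1) (hfix : ∀ w : InfinitePlace E, c • w = w)
  (w₁ : {w : InfinitePlace E // IsComplex w})

/-! ## §0 The local group `U(σ_{w₁}J)(ℂ)`: countability, local compactness; the commuting factors -/

section Local

omit [NumberField E] in
/-- `U(σ_{w₁}J)(ℂ) ≤ GL_N(ℂ)` is second countable (units of `M_N(ℂ) ≅ ℂ^{N²}` embed into `M_N(ℂ) × M_N(ℂ)ᵐᵒᵖ`). [cite: Folland1995, §2.2] -/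
theorem secondCountableTopology_archLocal : SecondCountableTopology (archLocal E N J w₁) := by
  haveI : SecondCountableTopology (Matrix (Fin N) (Fin N) ℂ) := inferInstanceAs (SecondCountableTopology (Fin N → Fin N → ℂ))
  haveI : SecondCountableTopology (Matrix (Fin N) (Fin N) ℂ)ᵐᵒᵖ := MulOpposite.opHomeomorph.symm.secondCountableTopology
  haveI : SecondCountableTopology (GL (Fin N) ℂ) := Units.isEmbedding_embedProduct.secondCountableTopology
  exact TopologicalSpace.Subtype.secondCountableTopology _

section LocCompact

open scoped Matrix.Norms.Operator

omit [NumberField E] in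
/-- `U(σ_{w₁}J)(ℂ)` is locally compact (a closed subgroup, ★ `isClosed_archLocal`, of the open unit group of the complete normed ring `M_N(ℂ)`).
[cite: Folland1995, §2.2] -/
theorem locallyCompactSpace_archLocal : LocallyCompactSpace (archLocal E N J w₁) := by
  haveI : LocallyCompactSpace (Matrix (Fin N) (Fin N) ℂ) := inferInstanceAs (LocallyCompactSpace (Fin N → Fin N → ℂ))
  haveI : LocallyCompactSpace (GL (Fin N) ℂ) := (Units.isOpenEmbedding_val (R := Matrix (Fin N) (Fin N) ℂ)).locallyCompactSpace
  exact (isClosed_archLocal E N J w₁).isClosedEmbedding_subtypeVal.locallyCompactSpace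

end LocCompact

/-- `K_c` commutes with the section at `w₁`: `Commute k (sec u)` (★ `adelicSingle_mul_eq_mul_of_mem_map_ker_archAt`). [cite: BorelJacquet1979, §4.1] -/
theorem commute_adelicSingle_of_mem_Kc {k : (adelicGroupData F E c N J).Adelic}
    (hk : k ∈ ((archAt F E c N J w₁ (hfix w₁.1) hc).ker).map (archToAdelic F E c N J)) (u : archLocal E N J w₁) :
    Commute k (adelicSingle F E c N J hc hfix w₁ u) :=
  (adelicSingle_mul_eq_mul_of_mem_map_ker_archAt F E c N J hc hfix w₁ u k hk).symm

/-- The finite-adelic factor commutes with the section at `w₁` (★ `adelicSingle_mul_finAdelicToAdelic`). [cite: BorelJacquet1979, §4.1] -/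
theorem commute_finAdelicToAdelic_adelicSingle (g : finAdelic F E c N J) (u : archLocal E N J w₁) :
    Commute (finAdelicToAdelic F E c N J g) (adelicSingle F E c N J hc hfix w₁ u) :=
  (adelicSingle_mul_finAdelicToAdelic F E c N J hc hfix w₁ u g).symm

/-- `K_c` commutes with the finite-adelic factor (★ `mul_finAdelicToAdelic_of_mem_map_ker_archAt`). [cite: BorelJacquet1979, §4.1] -/
theorem commute_finAdelicToAdelic_of_mem_Kc {k : (adelicGroupData F E c N J).Adelic}
    (hk : k ∈ ((archAt F E c N J w₁ (hfix w₁.1) hc).ker).map (archToAdelic F E c N J)) (g : finAdelic F E c N J) :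
    Commute k (finAdelicToAdelic F E c N J g) :=
  mul_finAdelicToAdelic_of_mem_map_ker_archAt F E c N J hc hfix w₁ k hk g

end Local

/-! ## §1 Exactly `K_c K_f`-invariant representatives by compact averaging -/

section Average

/-- **EXACTLY `K_c K_f`-INVARIANT REPRESENTATIVES.**  If the archimedean factor `K_c = (ker archAt w₁).map archToAdelic` away from `w₁` is
compact, an `L²` class `v` on the automorphic quotient of `U(J)(𝔸_F)` fixed by `K_c` and by a compact `K_f ≤ U(J)(𝔸_{F,f})` has a strongly
measurable square-integrable representative `F` invariant under `K_c` and `(1, K_f)` AT EVERY POINT: average the `L²` representative over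
`K_c`, then over `K_f` (Haar probability measures; ★ `average_ae_eq_of_forall_rightRegular_eq`, `average_smul_eq`, `average_smul_eq_of_commute` —
`K_c` and `(1, K_f)` commute). [cite: Folland1995, §2.2 and §3.2] [cite: BorelJacquet1979, §4.1] -/
theorem exists_invariant_representative
    (hKc : IsCompact (((archAt F E c N J w₁ (hfix w₁.1) hc).ker).map (archToAdelic F E c N J) : Set (adelicGroupData F E c N J).Adelic))
    (μ : Measure (adelicGroupData F E c N J).automorphicQuotient) [(adelicGroupData F E c N J).IsAutomorphicMeasure μ]
    (Kf : Subgroup (finAdelic F E c N J)) (hKfc : IsCompact (Kf : Set (finAdelic F E c N J)))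
    (v : (adelicGroupData F E c N J).L2 μ)
    (hkc : ∀ k ∈ ((archAt F E c N J w₁ (hfix w₁.1) hc).ker).map (archToAdelic F E c N J), (adelicGroupData F E c N J).rightRegular μ k v = v)
    (hkf : ∀ k ∈ Kf, (adelicGroupData F E c N J).rightRegular μ (finAdelicToAdelic F E c N J k) v = v) :
    ∃ Fv : (adelicGroupData F E c N J).automorphicQuotient → ℂ, StronglyMeasurable Fv ∧ (∃ hF : MemLp Fv 2 μ, hF.toLp Fv = v) ∧
      (∀ k ∈ ((archAt F E c N J w₁ (hfix w₁.1) hc).ker).map (archToAdelic F E c N J), ∀ ξ, Fv (k • ξ) = Fv ξ) ∧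
      (∀ k ∈ Kf, ∀ ξ, Fv (finAdelicToAdelic F E c N J k • ξ) = Fv ξ) := by
  haveI : SecondCountableTopology (adelicGroupData F E c N J).Adelic := inferInstanceAs (SecondCountableTopology (adelic F E c N J))
  haveI : SecondCountableTopology (finAdelic F E c N J) :=
    (isClosedEmbedding_finAdelicToAdelic F E c N J).isEmbedding.secondCountableTopology
  set F₀ : (adelicGroupData F E c N J).automorphicQuotient → ℂ := (v : (adelicGroupData F E c N J).automorphicQuotient → ℂ) with hF₀
  have hF₀m : StronglyMeasurable F₀ := Lp.stronglyMeasurable v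
  have hF₀mem : MemLp F₀ 2 μ := Lp.memLp v
  have hF₀toLp : hF₀mem.toLp F₀ = v := Lp.ext (MemLp.coeFn_toLp _)
  set Kc := ((archAt F E c N J w₁ (hfix w₁.1) hc).ker).map (archToAdelic F E c N J) with hKcdef
  haveI : CompactSpace Kc := isCompact_iff_compactSpace.mp hKc
  haveI : SecondCountableTopology Kc := Topology.IsEmbedding.subtypeVal.secondCountableTopology
  letI : MeasurableSpace Kc := borel Kc
  haveI : BorelSpace Kc := ⟨rfl⟩
  obtain ⟨ρ₁, hρ₁p, hρ₁i⟩ := Summit.HodgeConjecture.HodgeConjecture.Cruxes.H413.F0P2dStubR.exists_isProbabilityMeasure_isMulLeftInvariant Kc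
  haveI := hρ₁p
  haveI := hρ₁i
  have hc₁ : Continuous (Kc.subtype : Kc →* (adelicGroupData F E c N J).Adelic) := continuous_subtype_val
  set F₁ : (adelicGroupData F E c N J).automorphicQuotient → ℂ := fun ξ ↦ ∫ s, F₀ ((Kc.subtype s)⁻¹ • ξ) ∂ρ₁ with hF₁
  have hF₁ae : F₁ =ᵐ[μ] F₀ :=
    (adelicGroupData F E c N J).average_ae_eq_of_forall_rightRegular_eq μ ρ₁ hc₁ hF₀mem fun s ↦ by
      rw [hF₀toLp]; exact hkc s s.2
  have hF₁m : StronglyMeasurable F₁ := (adelicGroupData F E c N J).stronglyMeasurable_average ρ₁ hc₁ hF₀m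
  have hF₁mem : MemLp F₁ 2 μ := hF₀mem.ae_eq hF₁ae.symm
  have hF₁toLp : hF₁mem.toLp F₁ = v := Lp.ext ((MemLp.coeFn_toLp _).trans hF₁ae)
  have hF₁c : ∀ k ∈ Kc, ∀ ξ, F₁ (k • ξ) = F₁ ξ := fun k hk ξ ↦
    (adelicGroupData F E c N J).average_smul_eq ρ₁ F₀ (⟨k, hk⟩ : Kc) ξ (c := Kc.subtype)
  haveI : CompactSpace Kf := isCompact_iff_compactSpace.mp hKfc
  haveI : SecondCountableTopology Kf := Topology.IsEmbedding.subtypeVal.secondCountableTopology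
  letI : MeasurableSpace Kf := borel Kf
  haveI : BorelSpace Kf := ⟨rfl⟩
  obtain ⟨ρ₂, hρ₂p, hρ₂i⟩ := Summit.HodgeConjecture.HodgeConjecture.Cruxes.H413.F0P2dStubR.exists_isProbabilityMeasure_isMulLeftInvariant Kf
  haveI := hρ₂p
  haveI := hρ₂i
  set c₂ : Kf →* (adelicGroupData F E c N J).Adelic := (finAdelicToAdelic F E c N J).comp Kf.subtype with hc₂def
  have hc₂ : Continuous c₂ := (continuous_finAdelicToAdelic F E c N J).comp continuous_subtype_val
  set F₂ : (adelicGroupData F E c N J).automorphicQuotient → ℂ := fun ξ ↦ ∫ t, F₁ ((c₂ t)⁻¹ • ξ) ∂ρ₂ with hF₂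
  have hF₂ae : F₂ =ᵐ[μ] F₁ :=
    (adelicGroupData F E c N J).average_ae_eq_of_forall_rightRegular_eq μ ρ₂ hc₂ hF₁mem fun t ↦ by
      rw [hF₁toLp]; exact hkf t t.2
  have hF₂m : StronglyMeasurable F₂ := (adelicGroupData F E c N J).stronglyMeasurable_average ρ₂ hc₂ hF₁m
  have hF₂mem : MemLp F₂ 2 μ := hF₁mem.ae_eq hF₂ae.symm
  have hF₂toLp : hF₂mem.toLp F₂ = v :=
    Lp.ext ((MemLp.coeFn_toLp _).trans (hF₂ae.trans ((MemLp.coeFn_toLp _).symm.trans (Lp.ext_iff.1 hF₁toLp))))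
  have hF₂f : ∀ k ∈ Kf, ∀ ξ, F₂ (finAdelicToAdelic F E c N J k • ξ) = F₂ ξ := fun k hk ξ ↦
    (adelicGroupData F E c N J).average_smul_eq ρ₂ F₁ (⟨k, hk⟩ : Kf) ξ (c := c₂)
  have hF₂c : ∀ k ∈ Kc, ∀ ξ, F₂ (k • ξ) = F₂ ξ := fun k hk ξ ↦
    (adelicGroupData F E c N J).average_smul_eq_of_commute F₁ (hF₁c k hk) (c := c₂)
      (fun t : Kf ↦ commute_finAdelicToAdelic_of_mem_Kc F E c N J hc hfix w₁ hk t.1) ξ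
  exact ⟨F₂, hF₂m, ⟨hF₂mem, hF₂toLp⟩, hF₂c, hF₂f⟩

end Average

/-! ## §2 Exactly invariant functions: every orbit function is locally integrable; orbital integrals are continuous on `G(𝔸)` -/

section Good

/-- For an exactly `K_c`-invariant function the orbit functions of `k • ξ` and `ξ` COINCIDE (`K_c` commutes with `sec`).
[cite: BorelJacquet1979, §4.1] -/
theorem orbitFun_smul_of_mem_Kc (Fv : (adelicGroupData F E c N J).automorphicQuotient → ℂ)
    (hinvc : ∀ k ∈ ((archAt F E c N J w₁ (hfix w₁.1) hc).ker).map (archToAdelic F E c N J), ∀ ξ, Fv (k • ξ) = Fv ξ)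
    {k : (adelicGroupData F E c N J).Adelic} (hk : k ∈ ((archAt F E c N J w₁ (hfix w₁.1) hc).ker).map (archToAdelic F E c N J))
    (ξ : (adelicGroupData F E c N J).automorphicQuotient) :
    (fun u : archLocal E N J w₁ ↦ Fv ((adelicSingle F E c N J hc hfix w₁ u)⁻¹ • (k • ξ))) =
      fun u ↦ Fv ((adelicSingle F E c N J hc hfix w₁ u)⁻¹ • ξ) := by
  funext u
  rw [← mul_smul, ← ((commute_adelicSingle_of_mem_Kc F E c N J hc hfix w₁ hk u).inv_right).eq, mul_smul, hinvc k hk]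

/-- For an exactly `K_f`-invariant function the orbit functions of `(1,k) • ξ` and `ξ` COINCIDE. [cite: BorelJacquet1979, §4.1] -/
theorem orbitFun_smul_of_mem_finite (Fv : (adelicGroupData F E c N J).automorphicQuotient → ℂ) {Kf : Subgroup (finAdelic F E c N J)}
    (hinvf : ∀ k ∈ Kf, ∀ ξ, Fv (finAdelicToAdelic F E c N J k • ξ) = Fv ξ) {k : finAdelic F E c N J} (hk : k ∈ Kf)
    (ξ : (adelicGroupData F E c N J).automorphicQuotient) :
    (fun u : archLocal E N J w₁ ↦ Fv ((adelicSingle F E c N J hc hfix w₁ u)⁻¹ • (finAdelicToAdelic F E c N J k • ξ))) =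
      fun u ↦ Fv ((adelicSingle F E c N J hc hfix w₁ u)⁻¹ • ξ) := by
  funext u
  rw [← mul_smul, ← ((commute_finAdelicToAdelic_adelicSingle F E c N J hc hfix w₁ k u).inv_right).eq, mul_smul, hinvf k hk]

/-- **Every orbit function of an exactly `K_c K_f`-invariant `L¹` function is locally integrable** (`K_f` OPEN).  The set of bad points is
`μ`-null (★ `ae_locallyIntegrable_orbitFun`), and its preimage in `U(J)(𝔸_F)` is open: it is stable under left multiplication by
`sec(U) · K_c · (1, K_f)`, which contains the neighbourhood `{z | z_f ∈ K_f}` of `1` (★ `exists_eq_adelicSingle_mul_kerArchAt_mul_finAdelicToAdelic`);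
so the bad set is an open null set of the quotient, hence EMPTY (`μ` charges non-empty open sets). [cite: BorelJacquet1979, §4.1–4.2] [cite: Borel1997, §8.4] -/
theorem locallyIntegrable_orbitFun_of_invariant (μ : Measure (adelicGroupData F E c N J).automorphicQuotient)
    [(adelicGroupData F E c N J).IsAutomorphicMeasure μ]
    [MeasurableSpace (archLocal E N J w₁)] [BorelSpace (archLocal E N J w₁)] (ν : Measure (archLocal E N J w₁)) [ν.IsHaarMeasure]
    {Kf : Subgroup (finAdelic F E c N J)} (hKfo : IsOpen (Kf : Set (finAdelic F E c N J)))
    {Fv : (adelicGroupData F E c N J).automorphicQuotient → ℂ} (hFm : StronglyMeasurable Fv) (hFi : Integrable Fv μ)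
    (hinvc : ∀ k ∈ ((archAt F E c N J w₁ (hfix w₁.1) hc).ker).map (archToAdelic F E c N J), ∀ ξ, Fv (k • ξ) = Fv ξ)
    (hinvf : ∀ k ∈ Kf, ∀ ξ, Fv (finAdelicToAdelic F E c N J k • ξ) = Fv ξ)
    (ξ : (adelicGroupData F E c N J).automorphicQuotient) :
    LocallyIntegrable (fun u : archLocal E N J w₁ ↦ Fv ((adelicSingle F E c N J hc hfix w₁ u)⁻¹ • ξ)) ν := by
  haveI : SecondCountableTopology (adelicGroupData F E c N J).Adelic := inferInstanceAs (SecondCountableTopology (adelic F E c N J))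
  haveI := secondCountableTopology_archLocal E N J w₁
  haveI := locallyCompactSpace_archLocal E N J w₁
  have hι : Continuous (adelicSingle F E c N J hc hfix w₁) := continuous_adelicSingle F E c N J hc hfix w₁
  -- the good predicate and its invariances
  set Gd : (adelicGroupData F E c N J).automorphicQuotient → Prop :=
    fun ξ ↦ LocallyIntegrable (fun u : archLocal E N J w₁ ↦ Fv ((adelicSingle F E c N J hc hfix w₁ u)⁻¹ • ξ)) ν with hGd
  have h_arch : ∀ (g : archLocal E N J w₁) (η : (adelicGroupData F E c N J).automorphicQuotient),
      Gd (adelicSingle F E c N J hc hfix w₁ g • η) ↔ Gd η := fun g η ↦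
    (adelicGroupData F E c N J).locallyIntegrable_orbitFun_smul_iff ν Fv η g
  have h_c : ∀ k ∈ ((archAt F E c N J w₁ (hfix w₁.1) hc).ker).map (archToAdelic F E c N J), ∀ η, Gd (k • η) ↔ Gd η :=
    fun k hk η ↦ by simp only [hGd, orbitFun_smul_of_mem_Kc F E c N J hc hfix w₁ Fv hinvc hk]
  have h_f : ∀ k ∈ Kf, ∀ η, Gd (finAdelicToAdelic F E c N J k • η) ↔ Gd η :=
    fun k hk η ↦ by simp only [hGd, orbitFun_smul_of_mem_finite F E c N J hc hfix w₁ Fv hinvf hk]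
  -- the preimage of the bad set in the group is open
  have hP : IsOpen {y : (adelicGroupData F E c N J).Adelic | ¬ Gd ((adelicGroupData F E c N J).toAutomorphicQuotient y)} := by
    rw [isOpen_iff_mem_nhds]
    intro y₀ hy₀
    have hV : {y : (adelicGroupData F E c N J).Adelic | finPart F E c N J (y * y₀⁻¹) ∈ (Kf : Set (finAdelic F E c N J))} ∈ 𝓝 y₀ := by
      refine (hKfo.preimage ((continuous_finPart _ _ _ _ _).comp (continuous_id.mul continuous_const))).mem_nhds ?_
      show finPart F E c N J (y₀ * y₀⁻¹) ∈ Kf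
      rw [mul_inv_cancel, map_one]
      exact Kf.one_mem
    filter_upwards [hV] with y hy
    obtain ⟨u, k, g, hk, hdec⟩ := exists_eq_adelicSingle_mul_kerArchAt_mul_finAdelicToAdelic F E c N J hc hfix w₁ (y * y₀⁻¹)
    obtain ⟨a, -, hka⟩ := (mem_map_ker_archAt_iff F E c N J hc hfix w₁ k).1 hk
    have hg : finPart F E c N J (y * y₀⁻¹) = g := by
      rw [hdec, ← hka]
      simp only [map_mul, finPart_adelicSingle, finPart_archToAdelic, finPart_finAdelicToAdelic, one_mul]
    intro hgood
    apply hy₀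
    have hy' : (adelicGroupData F E c N J).toAutomorphicQuotient y = (y * y₀⁻¹) • (adelicGroupData F E c N J).toAutomorphicQuotient y₀ := by
      show (QuotientGroup.mk y : (adelicGroupData F E c N J).Adelic ⧸ (adelicGroupData F E c N J).quotientSubgroup) =
        (y * y₀⁻¹) • (QuotientGroup.mk y₀ : (adelicGroupData F E c N J).Adelic ⧸ (adelicGroupData F E c N J).quotientSubgroup)
      rw [MulAction.Quotient.smul_mk, smul_eq_mul, inv_mul_cancel_right]
    have h1 : Gd ((y * y₀⁻¹) • (adelicGroupData F E c N J).toAutomorphicQuotient y₀) := hy' ▸ hgood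
    have hgK : g ∈ Kf := by rw [← hg]; exact hy
    rw [hdec, mul_smul, mul_smul, h_arch, h_c k hk, h_f g hgK] at h1
    exact h1
  -- the bad set is the (open) image of its preimage, and is null
  have hBad : {ξ : (adelicGroupData F E c N J).automorphicQuotient | ¬ Gd ξ} =
      (adelicGroupData F E c N J).toAutomorphicQuotient '' {y | ¬ Gd ((adelicGroupData F E c N J).toAutomorphicQuotient y)} := by
    ext η
    constructor
    · intro h
      obtain ⟨y, rfl⟩ := QuotientGroup.mk_surjective η
      exact ⟨y, h, rfl⟩
    · rintro ⟨y, hy, rfl⟩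
      exact hy
  have hopen : IsOpen {ξ : (adelicGroupData F E c N J).automorphicQuotient | ¬ Gd ξ} := by
    rw [hBad]
    exact QuotientGroup.isOpenMap_coe _ hP
  have hnull : μ {ξ : (adelicGroupData F E c N J).automorphicQuotient | ¬ Gd ξ} = 0 :=
    ae_iff.1 ((adelicGroupData F E c N J).ae_locallyIntegrable_orbitFun μ ν hι hFm hFi)
  have hempty : {ξ : (adelicGroupData F E c N J).automorphicQuotient | ¬ Gd ξ} = ∅ := (hopen.measure_eq_zero_iff μ).1 hnull
  by_contra h
  have : ξ ∈ ({ξ : (adelicGroupData F E c N J).automorphicQuotient | ¬ Gd ξ} : Set _) := h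
  rw [hempty] at this
  exact this

/-- Group form: every base point of `U(J)(𝔸_F)` is good — the orbit function `u ↦ φ(x · sec u)` (`φ = invQuot F`) is locally integrable
for EVERY `x`. [cite: BorelJacquet1979, §4.1–4.2] -/
theorem locallyIntegrable_orbitFun_of_invariant' (μ : Measure (adelicGroupData F E c N J).automorphicQuotient)
    [(adelicGroupData F E c N J).IsAutomorphicMeasure μ]
    [MeasurableSpace (archLocal E N J w₁)] [BorelSpace (archLocal E N J w₁)] (ν : Measure (archLocal E N J w₁)) [ν.IsHaarMeasure]
    {Kf : Subgroup (finAdelic F E c N J)} (hKfo : IsOpen (Kf : Set (finAdelic F E c N J)))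
    {Fv : (adelicGroupData F E c N J).automorphicQuotient → ℂ} (hFm : StronglyMeasurable Fv) (hFi : Integrable Fv μ)
    (hinvc : ∀ k ∈ ((archAt F E c N J w₁ (hfix w₁.1) hc).ker).map (archToAdelic F E c N J), ∀ ξ, Fv (k • ξ) = Fv ξ)
    (hinvf : ∀ k ∈ Kf, ∀ ξ, Fv (finAdelicToAdelic F E c N J k • ξ) = Fv ξ)
    (x : (adelicGroupData F E c N J).Adelic) :
    LocallyIntegrable (fun u : archLocal E N J w₁ ↦ invQuot (adelicGroupData F E c N J) Fv (x * adelicSingle F E c N J hc hfix w₁ u)) ν := by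
  have h := locallyIntegrable_orbitFun_of_invariant F E c N J hc hfix w₁ μ ν hKfo hFm hFi hinvc hinvf
    ((adelicGroupData F E c N J).toAutomorphicQuotient x⁻¹)
  have e := (adelicGroupData F E c N J).orbitFun_inv_apply Fv x⁻¹ (ι := adelicSingle F E c N J hc hfix w₁)
  rw [inv_inv] at e
  rw [e]
  exact h

/-- **Right `K_c`-invariance of orbital integrals of an exactly invariant function**: `Θ(x k) = Θ(x)` for `k ∈ K_c`, where
`Θ(x) = ∫ β(u) φ(x sec(u)) dν(u)`, `φ = invQuot F`. [cite: BorelJacquet1979, §4.1] -/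
theorem orbitalIntegral_mul_of_mem_Kc [MeasurableSpace (archLocal E N J w₁)] (ν : Measure (archLocal E N J w₁))
    (β : archLocal E N J w₁ → ℂ) (Fv : (adelicGroupData F E c N J).automorphicQuotient → ℂ)
    (hinvc : ∀ k ∈ ((archAt F E c N J w₁ (hfix w₁.1) hc).ker).map (archToAdelic F E c N J), ∀ ξ, Fv (k • ξ) = Fv ξ)
    {k : (adelicGroupData F E c N J).Adelic} (hk : k ∈ ((archAt F E c N J w₁ (hfix w₁.1) hc).ker).map (archToAdelic F E c N J))
    (x : (adelicGroupData F E c N J).Adelic) :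
    (∫ u, β u * invQuot (adelicGroupData F E c N J) Fv (x * k * adelicSingle F E c N J hc hfix w₁ u) ∂ν) =
      ∫ u, β u * invQuot (adelicGroupData F E c N J) Fv (x * adelicSingle F E c N J hc hfix w₁ u) ∂ν := by
  congr 1 with u
  rw [mul_assoc, (commute_adelicSingle_of_mem_Kc F E c N J hc hfix w₁ hk u).eq, ← mul_assoc,
    ← apply_inv_smul_toAutomorphicQuotient_inv Fv k, hinvc k⁻¹ (inv_mem hk), invQuot_apply]

/-- `Θ(x · (1,k)) = Θ(x)` for `k ∈ K_f`. [cite: BorelJacquet1979, §4.1] -/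
theorem orbitalIntegral_mul_of_mem_finite [MeasurableSpace (archLocal E N J w₁)] (ν : Measure (archLocal E N J w₁))
    (β : archLocal E N J w₁ → ℂ) (Fv : (adelicGroupData F E c N J).automorphicQuotient → ℂ) {Kf : Subgroup (finAdelic F E c N J)}
    (hinvf : ∀ k ∈ Kf, ∀ ξ, Fv (finAdelicToAdelic F E c N J k • ξ) = Fv ξ) {k : finAdelic F E c N J} (hk : k ∈ Kf)
    (x : (adelicGroupData F E c N J).Adelic) :
    (∫ u, β u * invQuot (adelicGroupData F E c N J) Fv (x * finAdelicToAdelic F E c N J k * adelicSingle F E c N J hc hfix w₁ u) ∂ν) =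
      ∫ u, β u * invQuot (adelicGroupData F E c N J) Fv (x * adelicSingle F E c N J hc hfix w₁ u) ∂ν := by
  congr 1 with u
  rw [mul_assoc, (commute_finAdelicToAdelic_adelicSingle F E c N J hc hfix w₁ k u).eq, ← mul_assoc,
    ← apply_inv_smul_toAutomorphicQuotient_inv Fv (finAdelicToAdelic F E c N J k), ← map_inv, hinvf k⁻¹ (inv_mem hk), invQuot_apply]

/-- **Orbital integrals of an exactly `K_c K_f`-invariant good function are CONTINUOUS ON `U(J)(𝔸_F)`**: near `x₀`,
`Θ(x) = Θ(x₀ · sec((x₀⁻¹ x)_{w₁}))` by the decomposition `x₀⁻¹x = sec(u) · k · (1, g)` with `g = (x₀⁻¹x)_f ∈ K_f` (open condition) and the right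
invariances, and `g ↦ Θ(x₀ sec(g))` is continuous along the orbit (★ `continuous_orbitalIntegral_mul_hom`). (Also an instance of A-p02 (g18)'s ★
`UnitaryGroupSliceContinuity.continuous_of_continuous_slice`.) [cite: Borel1997, Thm. 2.13 and §8.4] [cite: BorelJacquet1979, §4.1] -/
theorem continuous_orbitalIntegral_of_invariant
    [MeasurableSpace (archLocal E N J w₁)] [BorelSpace (archLocal E N J w₁)] (ν : Measure (archLocal E N J w₁)) [ν.IsHaarMeasure]
    {Kf : Subgroup (finAdelic F E c N J)} (hKfo : IsOpen (Kf : Set (finAdelic F E c N J)))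
    {Fv : (adelicGroupData F E c N J).automorphicQuotient → ℂ}
    (hgood : ∀ x : (adelicGroupData F E c N J).Adelic,
      LocallyIntegrable (fun u : archLocal E N J w₁ ↦ invQuot (adelicGroupData F E c N J) Fv (x * adelicSingle F E c N J hc hfix w₁ u)) ν)
    (hinvc : ∀ k ∈ ((archAt F E c N J w₁ (hfix w₁.1) hc).ker).map (archToAdelic F E c N J), ∀ ξ, Fv (k • ξ) = Fv ξ)
    (hinvf : ∀ k ∈ Kf, ∀ ξ, Fv (finAdelicToAdelic F E c N J k • ξ) = Fv ξ)
    {β : archLocal E N J w₁ → ℂ} (hβ : Continuous β) (hβs : HasCompactSupport β) :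
    Continuous fun x : (adelicGroupData F E c N J).Adelic ↦
      ∫ u, β u * invQuot (adelicGroupData F E c N J) Fv (x * adelicSingle F E c N J hc hfix w₁ u) ∂ν := by
  haveI := secondCountableTopology_archLocal E N J w₁
  haveI := locallyCompactSpace_archLocal E N J w₁
  set Θ : (adelicGroupData F E c N J).Adelic → ℂ :=
    fun x ↦ ∫ u, β u * invQuot (adelicGroupData F E c N J) Fv (x * adelicSingle F E c N J hc hfix w₁ u) ∂ν with hΘ
  have hU : Continuous fun x : (adelicGroupData F E c N J).Adelic ↦ archAt F E c N J w₁ (hfix w₁.1) hc (archPart F E c N J x) :=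
    (continuous_archAt F E c N J w₁ (hfix w₁.1) hc).comp (continuous_archPart _ _ _ _ _)
  refine continuous_iff_continuousAt.2 fun x₀ ↦ ?_
  -- the continuous comparison function
  have hR : Continuous fun x : (adelicGroupData F E c N J).Adelic ↦
      Θ (x₀ * adelicSingle F E c N J hc hfix w₁ (archAt F E c N J w₁ (hfix w₁.1) hc (archPart F E c N J (x₀⁻¹ * x)))) :=
    ((adelicGroupData F E c N J).continuous_orbitalIntegral_mul_hom ν hβ hβs Fv (hgood x₀)).comp
      (hU.comp (continuous_const.mul continuous_id))
  have hV : {x : (adelicGroupData F E c N J).Adelic | finPart F E c N J (x₀⁻¹ * x) ∈ (Kf : Set (finAdelic F E c N J))} ∈ 𝓝 x₀ := by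
    refine (hKfo.preimage ((continuous_finPart _ _ _ _ _).comp (continuous_const.mul continuous_id))).mem_nhds ?_
    show finPart F E c N J (x₀⁻¹ * x₀) ∈ Kf
    rw [inv_mul_cancel, map_one]
    exact Kf.one_mem
  refine hR.continuousAt.congr_of_eventuallyEq ?_
  filter_upwards [hV] with x hx
  obtain ⟨u, k, g, hk, hdec⟩ := exists_eq_adelicSingle_mul_kerArchAt_mul_finAdelicToAdelic F E c N J hc hfix w₁ (x₀⁻¹ * x)
  -- identify the `w₁`-coordinate and the finite part of the decomposition
  obtain ⟨a, ha, hka⟩ := (mem_map_ker_archAt_iff F E c N J hc hfix w₁ k).1 hk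
  have hu : archAt F E c N J w₁ (hfix w₁.1) hc (archPart F E c N J (x₀⁻¹ * x)) = u := by
    rw [hdec, ← hka]
    simp only [map_mul, archPart_adelicSingle, archAt_archSingle_self, archPart_archToAdelic, ha, mul_one,
      archPart_finAdelicToAdelic]
  have hg : finPart F E c N J (x₀⁻¹ * x) = g := by
    rw [hdec, ← hka]
    simp only [map_mul, finPart_adelicSingle, finPart_archToAdelic, finPart_finAdelicToAdelic, one_mul]
  have hgK : g ∈ Kf := by rw [← hg]; exact hx
  have hx' : x = x₀ * (x₀⁻¹ * x) := by rw [mul_inv_cancel_left]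
  show Θ x = Θ _
  rw [hu]
  conv_lhs => rw [hx', hdec, ← mul_assoc, ← mul_assoc]
  rw [hΘ]
  simp only []
  rw [orbitalIntegral_mul_of_mem_finite F E c N J hc hfix w₁ ν β Fv hinvf hgK,
    orbitalIntegral_mul_of_mem_Kc F E c N J hc hfix w₁ ν β Fv hinvc hk]

end Good

end Summit.HodgeConjecture.HodgeConjecture.Cruxes.HLiu418.F0P5TP2StubR2Engine

end
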